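import Summits.BirchSwinnertonDyer.BirchSwinnertonDyer.Theorems.ClassRecordThreeEulerHalvesAtThreeCartanDegreeDefs
import HarnessLib

/-!
# Crux 23422 `EulerHalvesAtThreeResidualUpperBound`, line `cartan`, the Cartan degree law (F2) cut — file 1/2: the LATTICE degree law from S-K1′ and
# the prime `q = 2` PROVED (`W_2 = sgn`, rank one: S-K1′ holds trivially there)

Seat `bsd-stepL-tam3-p1` (g20), LINE OWNER of crux 23422 (`--supports stmt-BirchSwinnertonDyer-23422 --as helper`). CONTENT = bsd-idea-10 g10's unregistered
workfile `Cruxes/EulerHalvesAtThree/Lines/cartan_degree.lean` r2 (53799b0f4d965e0e) §1 (the lattice law) and §1b (`q = 2`) VERBATIM as to the proofs (file 2/2 `…CartanDegreeOfStubs` carries §4, the derivation,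
with the workfile's three `sorry`-stubs turned into HYPOTHESES (`hF2a : CubicTorusPeriodRatioAtThreeGeFive`,
`hF20 : CartanEmptyDegreeIndep`, `hF2b : CartanHomLatticeDictionaryAtThree`, the named `Prop`s of `…CartanDegreeDefs`) so that the file is sorry-free
and the line's skeleton v8 can state those three as its registered stubs and DERIVE v7's `stub_cartanDegreeLawAtThree` by `cartanDegreeLawAtThree_derived`.
CREDIT: bsd-idea-10 g7–g10 (all proofs), idea-crit-14 (V49∕V57∕V70∕V79). HONEST FRAMING: theorems only; CONDITIONAL on the displayed hypotheses; nothing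
is asserted about any curve; the degree law (F2) is NOT proved (it is derived from three open inputs, two beyond print); no summit statement, no route
item is proved; BSD is proved for no curve. References: [cite: KohenPacetti2016, Rem. 3.8 (p. 15), §2] [cite: CaiShuTian2014, §1.2 p. 5]
[cite: VignerasLNM800, Ch. III §5] [cite: PastenShimura2024, §2 p. 12 (admissible factorisation)].
-- adapted from Summits/BirchSwinnertonDyer/BirchSwinnertonDyer/Cruxes/EulerHalvesAtThree/Lines/cartan_degree.lean r2 (bsd-idea-10 g10), §1, §1b, §2, §4
-/

set_option linter.dupNamespace false
set_option autoImplicit false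

noncomputable section

open scoped Classical MatrixGroups NumberField UpperHalfPlane

namespace Summit.BirchSwinnertonDyer.BirchSwinnertonDyer.Theorems.CartanDegree

open WeierstrassCurve IsDedekindDomain NumberField Field Literature.NumberTheory.EllipticCurves
  Literature.NumberTheory.EllipticCurves.ModularForms
  Literature.NumberTheory.EllipticCurves.Rank1Residual Literature.NumberTheory.Automorphic
  Summit.BirchSwinnertonDyer.Rank1Residual Summit.BirchSwinnertonDyer.BirchSwinnertonDyer.Theorems

/-! ## §1 The lattice degree law from S-K1′ -/

/-- PROVED: S-K1′ ⇒ the lattice degree law (`sheet_s`, `sheet_C` give `B(u_s,u_s)·(q+1)·degC = B(u_C,u_C)·(q−1)·degX0`;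
`B(u_T,u_T) = idx_T²·B(w_T,w_T)` with `3 ∤ idx_T`; then S-K1′). [folklore] -/
theorem latticeDegreeLaw_of_periodRatio (h : CubicTorusPeriodRatioAtThree) : LatticeDegreeLawAtThree := by
  intro q hq hq3 𝒟
  haveI : Fact (Nat.Prime 3) := ⟨Nat.prime_three⟩
  have hq1' : 1 < q := hq.one_lt
  set L := 𝒟.toCartanTorusLattice with hL
  have hper := h q hq hq3 L 𝒟.wS 𝒟.wC 𝒟.wS_fixed 𝒟.wS_gen 𝒟.wC_fixed 𝒟.wC_gen
  set bS : ℤ := L.B 𝒟.uS 𝒟.uS with hbS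
  set bC : ℤ := L.B 𝒟.uC 𝒟.uC with hbC
  have hq1 : (1 : ℚ) < (q : ℚ) := by exact_mod_cast hq1'
  have hcne : 𝒟.c ≠ 0 := ne_of_gt 𝒟.c_pos
  have key : (bS : ℚ) * ((q : ℚ) + 1) * (𝒟.degC : ℚ) = (bC : ℚ) * ((q : ℚ) - 1) * (𝒟.degX0 : ℚ) := by
    have h1 := 𝒟.sheet_s
    have h2 := 𝒟.sheet_C
    have hq1'' : (q : ℚ) - 1 ≠ 0 := by linarith
    have e : ((bS : ℚ) * ((q : ℚ) + 1) * (𝒟.degC : ℚ)) * (𝒟.c * ((q : ℚ) - 1))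
        = ((bC : ℚ) * ((q : ℚ) - 1) * (𝒟.degX0 : ℚ)) * (𝒟.c * ((q : ℚ) - 1)) := by
      calc ((bS : ℚ) * ((q : ℚ) + 1) * (𝒟.degC : ℚ)) * (𝒟.c * ((q : ℚ) - 1))
          = (𝒟.c * (bS : ℚ)) * (((q : ℚ) ^ 2 - 1) * (𝒟.degC : ℚ)) := by ring
        _ = (((q : ℚ) - 1) ^ 2 / 2 * (𝒟.degX0 : ℚ)) * (((q : ℚ) ^ 2 - 1) * (𝒟.degC : ℚ)) := by rw [h1]
        _ = (((q : ℚ) ^ 2 - 1) / 2 * (𝒟.degC : ℚ)) * (((q : ℚ) - 1) ^ 2 * (𝒟.degX0 : ℚ)) := by ring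
        _ = (𝒟.c * (bC : ℚ)) * (((q : ℚ) - 1) ^ 2 * (𝒟.degX0 : ℚ)) := by rw [h2]
        _ = ((bC : ℚ) * ((q : ℚ) - 1) * (𝒟.degX0 : ℚ)) * (𝒟.c * ((q : ℚ) - 1)) := by ring
    exact mul_right_cancel₀ (mul_ne_zero hcne hq1'') e
  have keyZ : bS * ((q : ℤ) + 1) * (𝒟.degC : ℤ) = bC * ((q : ℤ) - 1) * (𝒟.degX0 : ℤ) := by
    exact_mod_cast key
  have huS : 𝒟.uS ≠ 0 := by
    intro h0
    have : (bS : ℚ) = 0 := by simp [hbS, h0]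
    have h1 := 𝒟.sheet_s
    rw [this, mul_zero] at h1
    have : (0 : ℚ) < ((q : ℚ) - 1) ^ 2 / 2 * (𝒟.degX0 : ℚ) := by
      have : (0 : ℚ) < 𝒟.degX0 := by exact_mod_cast 𝒟.degX0_pos
      positivity
    linarith
  have huC : 𝒟.uC ≠ 0 := by
    intro h0
    have : (bC : ℚ) = 0 := by simp [hbC, h0]
    have h2 := 𝒟.sheet_C
    rw [this, mul_zero] at h2
    have : (0 : ℚ) < ((q : ℚ) ^ 2 - 1) / 2 * (𝒟.degC : ℚ) := by
      have : (0 : ℚ) < 𝒟.degC := by exact_mod_cast 𝒟.degC_pos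
      have : (0 : ℚ) < (q : ℚ) ^ 2 - 1 := by nlinarith
      positivity
    linarith
  have hwS : 𝒟.wS ≠ 0 := by
    intro h0; apply huS; rw [𝒟.uS_eq, h0, smul_zero]
  have hwC : 𝒟.wC ≠ 0 := by
    intro h0; apply huC; rw [𝒟.uC_eq, h0, smul_zero]
  have hbS_pos : 0 < bS := L.B_pos _ huS
  have hbC_pos : 0 < bC := L.B_pos _ huC
  have hBwS_pos : 0 < L.B 𝒟.wS 𝒟.wS := L.B_pos _ hwS
  have hBwC_pos : 0 < L.B 𝒟.wC 𝒟.wC := L.B_pos _ hwC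
  have hbS_eq : bS = 𝒟.idxS * 𝒟.idxS * L.B 𝒟.wS 𝒟.wS := by
    simp only [hbS, 𝒟.uS_eq, map_smul, LinearMap.smul_apply, smul_eq_mul]; ring
  have hbC_eq : bC = 𝒟.idxC * 𝒟.idxC * L.B 𝒟.wC 𝒟.wC := by
    simp only [hbC, 𝒟.uC_eq, map_smul, LinearMap.smul_apply, smul_eq_mul]; ring
  have hidxS : 𝒟.idxS ≠ 0 := by
    intro h0; rw [h0] at hbS_eq; simp at hbS_eq; omega
  have hidxC : 𝒟.idxC ≠ 0 := by
    intro h0; rw [h0] at hbC_eq; simp at hbC_eq; omega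
  have vS : padicValInt 3 bS = padicValInt 3 (L.B 𝒟.wS 𝒟.wS) := by
    have hi : padicValNat 3 𝒟.idxS.natAbs = 0 := by
      apply padicValNat.eq_zero_of_not_dvd
      intro hd; exact 𝒟.descent_s (Int.ofNat_dvd_left.mpr hd)
    simp only [padicValInt, hbS_eq, Int.natAbs_mul]
    rw [padicValNat.mul (by positivity) (by positivity), padicValNat.mul (by positivity) (by positivity), hi]
    simp
  have vC : padicValInt 3 bC = padicValInt 3 (L.B 𝒟.wC 𝒟.wC) := by
    have hi : padicValNat 3 𝒟.idxC.natAbs = 0 := by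
      apply padicValNat.eq_zero_of_not_dvd
      intro hd; exact 𝒟.descent_C (Int.ofNat_dvd_left.mpr hd)
    simp only [padicValInt, hbC_eq, Int.natAbs_mul]
    rw [padicValNat.mul, padicValNat.mul, hi]
    · simp
    all_goals first
      | exact Int.natAbs_ne_zero.mpr hidxC
      | exact mul_ne_zero (Int.natAbs_ne_zero.mpr hidxC) (Int.natAbs_ne_zero.mpr hidxC)
      | exact Int.natAbs_ne_zero.mpr (ne_of_gt hBwC_pos)
  have keyN : bS.natAbs * (q + 1) * 𝒟.degC = bC.natAbs * (q - 1) * 𝒟.degX0 := by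
    have h' := congrArg Int.natAbs keyZ
    simp only [Int.natAbs_mul] at h'
    have e1 : ((q : ℤ) + 1).natAbs = q + 1 := by omega
    have e2 : ((q : ℤ) - 1).natAbs = q - 1 := by omega
    simpa [e1, e2] using h'
  have hval := congrArg (padicValNat 3) keyN
  rw [padicValNat.mul (mul_ne_zero (Int.natAbs_ne_zero.mpr (ne_of_gt hbS_pos)) (by omega)) (by have := 𝒟.degC_pos; omega),
      padicValNat.mul (Int.natAbs_ne_zero.mpr (ne_of_gt hbS_pos)) (by omega),
      padicValNat.mul (mul_ne_zero (Int.natAbs_ne_zero.mpr (ne_of_gt hbC_pos)) (by omega)) (by have := 𝒟.degX0_pos; omega),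
      padicValNat.mul (Int.natAbs_ne_zero.mpr (ne_of_gt hbC_pos)) (by omega)] at hval
  have vS' : padicValNat 3 bS.natAbs = padicValInt 3 (L.B 𝒟.wS 𝒟.wS) := vS
  have vC' : padicValNat 3 bC.natAbs = padicValInt 3 (L.B 𝒟.wC 𝒟.wC) := vC
  rw [vS'] at hval; rw [vC'] at hval
  omega

/-! ## §1b The prime `q = 2` (PROVED): `W_2 = sgn`, rank one, both tori fix the line — S-K1′ holds trivially -/

section Two

/-- `χ_{W_2}(1) = 1` (`= dim W_2`). [folklore] -/
theorem cubicNewvectorChar_two_one : cubicNewvectorChar 2 1 = 1 := by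
  have hΔ : (1 : Matrix (Fin 2) (Fin 2) (ZMod 2)).trace ^ 2 - 4 * (1 : Matrix (Fin 2) (Fin 2) (ZMod 2)).det = 0 := by
    rw [Matrix.trace_one, Matrix.det_one]; decide
  have hsc : IsScalarMat (1 : Matrix (Fin 2) (Fin 2) (ZMod 2)) := by simp [IsScalarMat]
  have h23 : ¬ (2 % 3 = 1) := by decide
  show cubicNewvectorCharMat 2 ((1 : GL (Fin 2) (ZMod 2)) : Matrix (Fin 2) (Fin 2) (ZMod 2)) = 1
  rw [show ((1 : GL (Fin 2) (ZMod 2)) : Matrix (Fin 2) (Fin 2) (ZMod 2)) = 1 from rfl]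
  simp only [cubicNewvectorCharMat, h23, if_false, hΔ, hsc, if_true]
  norm_num

/-- An endomorphism of `ℤ¹` is multiplication by its trace. [folklore] -/
theorem endo_apply_eq_trace_smul {n : ℕ} (hn : n = 1) (f : (Fin n → ℤ) →ₗ[ℤ] (Fin n → ℤ)) (v : Fin n → ℤ) :
    f v = (LinearMap.trace ℤ (Fin n → ℤ) f) • v := by
  subst hn
  have htr : LinearMap.trace ℤ (Fin 1 → ℤ) f = f (Pi.single 0 1) 0 := by
    rw [LinearMap.trace_eq_matrix_trace ℤ (Pi.basisFun ℤ (Fin 1)) f, Matrix.trace_fin_one, LinearMap.toMatrix_apply,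
      Pi.basisFun_repr, Pi.basisFun_apply]
  have hv : v = v 0 • (Pi.single 0 1 : Fin 1 → ℤ) := by
    funext i; fin_cases i; simp
  rw [htr]
  conv_lhs => rw [hv]
  rw [map_smul]
  funext i; fin_cases i
  simp [mul_comm]

/-- In `GL₂(𝔽₂)` the diagonal torus is trivial. [folklore] -/
theorem gl2_two_eq_one_of_diag (g : GL (Fin 2) (ZMod 2)) (h01 : (g : Matrix (Fin 2) (Fin 2) (ZMod 2)) 0 1 = 0)
    (h10 : (g : Matrix (Fin 2) (Fin 2) (ZMod 2)) 1 0 = 0) : g = 1 := by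
  have hdet : (g : Matrix (Fin 2) (Fin 2) (ZMod 2)).det ≠ 0 := by
    rw [← Matrix.GeneralLinearGroup.val_det_apply]; exact Units.ne_zero _
  rw [Matrix.det_fin_two, h01, h10] at hdet
  have key : ∀ a d : ZMod 2, a * d - 0 * 0 ≠ 0 → a = 1 ∧ d = 1 := by decide
  obtain ⟨ha, hd⟩ := key _ _ hdet
  refine Matrix.GeneralLinearGroup.ext fun i j => ?_
  fin_cases i <;> fin_cases j <;> simp [ha, hd, h01, h10]

set_option synthInstance.maxSize 8192 in
set_option synthInstance.maxHeartbeats 400000 in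
/-- In `GL₂(𝔽₂) ≅ S₃` the centraliser of an element `η` with irreducible characteristic polynomial (a `3`-cycle) is `A₃ = {1, η, η²}`,
on which `χ_{W_2} = sgn` is `1`: an element commuting with `η` is `1` or has `χ = 1`. Finite check on entries. [folklore] -/
theorem gl2_two_centraliser (η : Matrix (Fin 2) (Fin 2) (ZMod 2)) (hη : ¬ HasRatEigenvalue η) (g : GL (Fin 2) (ZMod 2))
    (hg : (g : Matrix (Fin 2) (Fin 2) (ZMod 2)) * η = η * g) : g = 1 ∨ cubicNewvectorChar 2 g = 1 := by
  set G : Matrix (Fin 2) (Fin 2) (ZMod 2) := (g : Matrix (Fin 2) (Fin 2) (ZMod 2)) with hG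
  have hdet : G.det ≠ 0 := by
    rw [hG, ← Matrix.GeneralLinearGroup.val_det_apply]; exact Units.ne_zero _
  have e00 := congrFun (congrFun hg 0) 0
  have e01 := congrFun (congrFun hg 0) 1
  have e10 := congrFun (congrFun hg 1) 0
  have e11 := congrFun (congrFun hg 1) 1
  simp only [Matrix.mul_apply, Fin.sum_univ_two] at e00 e01 e10 e11
  have key : ∀ (a b c d e f i h : ZMod 2), (¬ ∃ x : ZMod 2, x * x + (e * h - f * i) = (e + h) * x) →
      a * e + b * i = e * a + f * c → a * f + b * h = e * b + f * d → c * e + d * i = i * a + h * c →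
      c * f + d * h = i * b + h * d → a * d - b * c ≠ 0 →
      (a = 1 ∧ b = 0 ∧ c = 0 ∧ d = 1) ∨
        ((a + d) ^ 2 - 4 * (a * d - b * c) ≠ 0 ∧ (¬ ∃ x : ZMod 2, x * x + (a * d - b * c) = (a + d) * x) ∧
          ¬ (a = 1 ∧ b = 0 ∧ c = 0 ∧ d = 1)) := by
    decide
  have hη' : ¬ ∃ x : ZMod 2, x * x + (η 0 0 * η 1 1 - η 0 1 * η 1 0) = (η 0 0 + η 1 1) * x := by
    simpa [HasRatEigenvalue, Matrix.det_fin_two, Matrix.trace_fin_two] using hη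
  have hdet' : G 0 0 * G 1 1 - G 0 1 * G 1 0 ≠ 0 := by simpa [Matrix.det_fin_two] using hdet
  rcases key (G 0 0) (G 0 1) (G 1 0) (G 1 1) (η 0 0) (η 0 1) (η 1 0) (η 1 1) hη' e00 e01 e10 e11 hdet' with
    ⟨ha, hb, hc, hd⟩ | ⟨hΔ, hrat, hne⟩
  · left
    refine Matrix.GeneralLinearGroup.ext fun i j => ?_
    fin_cases i <;> fin_cases j <;> simp [← hG, ha, hb, hc, hd]
  · right
    have hΔ' : G.trace ^ 2 - 4 * G.det ≠ 0 := by simpa [Matrix.det_fin_two, Matrix.trace_fin_two] using hΔ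
    have hrat' : ¬ HasRatEigenvalue G := by simpa [HasRatEigenvalue, Matrix.det_fin_two, Matrix.trace_fin_two] using hrat
    have hne' : ¬ G ^ ((2 ^ 2 - 1) / 3) = 1 := by
      intro h1
      norm_num at h1
      apply hne
      have h := fun i j => congrFun (congrFun h1 i) j
      refine ⟨by simpa using h 0 0, by simpa using h 0 1, by simpa using h 1 0, by simpa using h 1 1⟩
    have h23 : ¬ (2 % 3 = 1) := by decide
    simp only [cubicNewvectorChar, cubicNewvectorCharMat, ← hG, h23, if_false, hΔ', hrat', hne']

/-- **S-K1′ at `q = 2`, PROVED**: for every Cartan torus lattice at `2` (necessarily of rank one, `ρ = sgn`), generators of the two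
torus-fixed lines have the same `B`-value, and `ord₃(2+1) = 1 = 1 + ord₃(2−1)`. [folklore] -/
theorem cubicTorusPeriodRatio_two (𝓛 : CartanTorusLattice 2) (wS wC : Fin 𝓛.d → ℤ)
    (_hS : 𝓛.IsSplitFixed wS) (hSg : ∀ v, 𝓛.IsSplitFixed v → ∃ m : ℤ, v = m • wS)
    (_hC : 𝓛.IsNonsplitFixed wC) (hCg : ∀ v, 𝓛.IsNonsplitFixed v → ∃ m : ℤ, v = m • wC) :
    padicValInt 3 (𝓛.B wS wS) + padicValNat 3 (2 + 1) = padicValInt 3 (𝓛.B wC wC) + 1 + padicValNat 3 (2 - 1) := by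
  haveI : Fact (Nat.Prime 3) := ⟨Nat.prime_three⟩
  -- rank one
  have hd : 𝓛.d = 1 := by
    have h := 𝓛.trace_eq 1
    rw [map_one, LinearMap.trace_one, Module.finrank_fin_fun, cubicNewvectorChar_two_one] at h
    exact_mod_cast h
  -- every vector is fixed by the (trivial) split torus
  have hsplit_all : ∀ v, 𝓛.IsSplitFixed v := by
    intro v g h01 h10
    rw [gl2_two_eq_one_of_diag g h01 h10, map_one]
    rfl
  -- every vector is fixed by the non-split torus (`A₃` acts through `sgn = 1`)
  have hns_all : ∀ v, 𝓛.IsNonsplitFixed v := by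
    intro v g hg
    rcases gl2_two_centraliser 𝓛.η 𝓛.η_irred g hg with h1 | hχ
    · rw [h1, map_one]; rfl
    · have htr := 𝓛.trace_eq g
      rw [hχ] at htr
      rw [endo_apply_eq_trace_smul hd (𝓛.ρ g) v, htr, one_smul]
  obtain ⟨m, hm⟩ := hSg wC (hsplit_all wC)
  obtain ⟨m', hm'⟩ := hCg wS (hns_all wS)
  have hwS : wS ≠ 0 := by
    intro h0
    obtain ⟨k, hk⟩ := hSg (fun _ => 1) (hsplit_all _)
    rw [h0, smul_zero] at hk
    have h := congrFun hk ⟨0, by omega⟩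
    simp at h
  have hmm : m' * m = 1 := by
    have h2 : (m' * m - 1) • wS = 0 := by
      rw [sub_smul, one_smul, ← smul_smul, ← hm, ← hm', sub_self]
    rcases smul_eq_zero.mp h2 with h3 | h3
    · linarith
    · exact absurd h3 hwS
  have hm1 : m * m = 1 := by
    rcases Int.eq_one_or_neg_one_of_mul_eq_one' hmm with ⟨-, h⟩ | ⟨-, h⟩ <;> subst h <;> norm_num
  have hB : 𝓛.B wC wC = 𝓛.B wS wS := by
    rw [hm]
    simp only [map_smul, LinearMap.smul_apply, smul_eq_mul]
    rw [← mul_assoc, hm1, one_mul]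
  rw [hB]
  norm_num

/-- PROVED: S-K1′ for all primes `q ≠ 3` follows from S-K1′ on `q ≥ 5` (the stub) and the `q = 2` theorem. [folklore] -/
theorem cubicTorusPeriodRatioAtThree_of_geFive (h : CubicTorusPeriodRatioAtThreeGeFive) : CubicTorusPeriodRatioAtThree := by
  intro q hq hq3
  by_cases h5 : 5 ≤ q
  · exact h q hq h5
  · have h2 : q = 2 := by
      have hq2 := hq.two_le
      interval_cases q
      · rfl
      · exact absurd rfl hq3
      · exact absurd hq (by decide)
    subst h2
    intro 𝓛 wS wC hS hSg hC hCg
    exact cubicTorusPeriodRatio_two 𝓛 wS wC hS hSg hC hCg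

end Two


end Summit.BirchSwinnertonDyer.BirchSwinnertonDyer.Theorems.CartanDegree

end
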